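import Summits.NavierStokesRegularity.NavierStokesRegularity.Theorems.RungBlowupCofinal.Negative.ForwardStubParasitic
import Summits.NavierStokesRegularity.FluidComputer.AngularGalerkinLadderBasics
import HarnessLib

/-!
# The Type-I TAIL is the load-bearing hypothesis of PURE-WAVE EXCLUSION: without it the linear
# precessing profile equation — even with ALL mean–wave letters at `(L, n) = (1, 1)` — is
# inhabited by the constant horizontal field (route `AngularGalerkinLadder`, crux K1
# `RungBlowupCofinal`; junk audit, theorems only)

Cell `ns-blowup`, seat `ns-blowup-circuit` (g12, AGL Lean seat). Companion of
`PureWaveExclusion.lean` (`eq_zero_of_linearProfile`: a band-limited divergence-free `W` with Type-I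
tail solving `−ΔW + ½W + ½DW·y + αJ₃W + ∇Q = E`, `E` co-band, is zero). This file shows that
the TAIL hypothesis `‖W(y)‖ ≤ C/(‖y‖ + 1)` cannot be dropped: for every level `L ≥ 1`, every
precession rate `α` and every vector `c`, the CONSTANT field `W ≡ c` solves the equation with the
linear pressure `Q(y) = −⟪½c + α(e₃ × c), y⟫` and ZERO defect (`linearProfile_const`), is
band-limited (`j = 1`, tree `isBandLimited_const`), divergence free, and is non-zero for `c ≠ 0`.
Moreover for HORIZONTAL `c` (`c₂ = 0`) it is a `1`-fold azimuthal wave (`J₃²c = −c`,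
`wave_const_horizontal`) with vanishing mean Reynolds stress, so at `(L, n) = (1, 1)` the pair
`(V, W) = (0, c)` satisfies EVERY conjunct of `Qlwave.IsMeanWaveProfile 1 1 α C 0 c 0 Q 0 0` except
the tail (`meanWave_letters_const_horizontal`) — the analogue, for the line `qlwave`, of the
parasitic/junk audits KJ-18/KJ-20 of the forward letters. (The co-band hypothesis on `E` is
trivially load-bearing too: without it any `W` solves the equation with `E :=` its residual.)

LABEL: KERNEL junk audit. Nothing here asserts a Theses declaration; no definition, no named fact,
no sorry. WHAT THIS IS NOT: not Navier–Stokes evidence; not a profile (constant fields have no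
Type-I tail and infinite energy). References: [cite: KochNadirashviliSereginSverak2009, §1 p. 3
(parasitic solutions `u = b(t)`, `p = −b'(t)·x`)]; [cite: BullardGellman1954].
-/

noncomputable section

namespace Summit.NavierStokesRegularity.AngularGalerkinLadderLinearProfileTailLoadBearing

open Set Function InnerProductSpace
open scoped RealInnerProductSpace Laplacian ContDiff
open Literature.Analysis.FluidPDE
open Summit.NavierStokesRegularity.FluidComputer
open Summit.NavierStokesRegularity.FluidComputer.AngularLadder
open Summit.NavierStokesRegularity.RungBlowupCofinalForwardStubParasitic

/-- `∇ₓ ⟪v, x⟫ = v` (Riesz). [folklore] -/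
private theorem gradient_inner_left' (v x : EuclideanSpace ℝ (Fin 3)) :
    gradient (fun y : EuclideanSpace ℝ (Fin 3) => ⟪v, y⟫) x = v := by
  refine HasGradientAt.gradient ?_
  rw [hasGradientAt_iff_hasFDerivAt]
  have hd : (InnerProductSpace.toDual ℝ (EuclideanSpace ℝ (Fin 3)) v :
      EuclideanSpace ℝ (Fin 3) →L[ℝ] ℝ) = innerSL ℝ v := by
    ext y
    rfl
  rw [hd]
  exact (innerSL ℝ v).hasFDerivAt

/-- A constant field is divergence free. [folklore] -/
private theorem isDivFree_const (c : EuclideanSpace ℝ (Fin 3)) :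
    VectorCalculus.IsDivFree (fun _ : EuclideanSpace ℝ (Fin 3) => c) := fun x => by
  simp only [VectorCalculus.divergence, fderiv_fun_const, Pi.zero_apply,
    ContinuousLinearMap.toLinearMap_zero, map_zero]

/-- **The constant field solves the linear precessing profile equation with zero defect.** For
every `α` and `c`, `W ≡ c` and `Q(y) = −⟪½c + α(e₃ × c), y⟫` satisfy
`−ΔW + ½W + ½DW·y + αJ₃W + ∇Q = 0` pointwise (`ΔW = 0`, `DW = 0`, `J₃W = e₃ × c`). [folklore] -/
theorem linearProfile_const (α : ℝ) (c : EuclideanSpace ℝ (Fin 3)) (y : EuclideanSpace ℝ (Fin 3)) :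
    -(Δ (fun _ : EuclideanSpace ℝ (Fin 3) => c)) y + (1 / 2 : ℝ) • (fun _ : EuclideanSpace ℝ (Fin 3) => c) y +
      (1 / 2 : ℝ) • fderiv ℝ (fun _ : EuclideanSpace ℝ (Fin 3) => c) y y +
      α • angGen 2 (fun _ : EuclideanSpace ℝ (Fin 3) => c) y +
      gradient (fun z : EuclideanSpace ℝ (Fin 3) => -⟪(1 / 2 : ℝ) • c + α • cross (axis 2) c, z⟫) y =
      0 := by
  have hΔ : (Δ (fun _ : EuclideanSpace ℝ (Fin 3) => c)) y = 0 := by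
    rw [InnerProductSpace.laplacian_const]; rfl
  have hg : gradient (fun z : EuclideanSpace ℝ (Fin 3) => -⟪(1 / 2 : ℝ) • c + α • cross (axis 2) c, z⟫) y
      = -((1 / 2 : ℝ) • c + α • cross (axis 2) c) := by
    have e : (fun z : EuclideanSpace ℝ (Fin 3) => -⟪(1 / 2 : ℝ) • c + α • cross (axis 2) c, z⟫) =
        fun z => ⟪-((1 / 2 : ℝ) • c + α • cross (axis 2) c), z⟫ := by
      funext z; rw [inner_neg_left]
    rw [e, gradient_inner_left']
  rw [hΔ, hg, angGen_const, fderiv_fun_const]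
  simp only [Pi.zero_apply, _root_.zero_apply, smul_zero, add_zero, neg_zero, zero_add]
  abel

/-- **The Type-I tail is load-bearing in `PureWaveExclusion.eq_zero_of_linearProfile`.** For
every `L ≥ 1`, every `α` and every `c ≠ 0` there are `W ≠ 0`, a smooth `Q` and a co-band-limited
`E` (namely `W ≡ c`, `Q(y) = −⟪½c + α(e₃ × c), y⟫`, `E ≡ 0`) meeting every hypothesis of the
exclusion theorem except the tail `‖W(y)‖ ≤ C/(‖y‖ + 1)`. [cite: KochNadirashviliSereginSverak2009, §1 p. 3 (parasitic solutions)] -/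
theorem linearProfile_inhabited_without_tail {L : ℕ} (hL : 1 ≤ L) (α : ℝ)
    {c : EuclideanSpace ℝ (Fin 3)} (hc : c ≠ 0) :
    ∃ (W E : EuclideanSpace ℝ (Fin 3) → EuclideanSpace ℝ (Fin 3)) (Q : EuclideanSpace ℝ (Fin 3) → ℝ),
      IsBandLimited L W ∧ VectorCalculus.IsDivFree W ∧ ContDiff ℝ ∞ Q ∧ IsCobandLimited L E ∧
      (∀ y, -(Δ W) y + (1 / 2 : ℝ) • W y + (1 / 2 : ℝ) • fderiv ℝ W y y + α • angGen 2 W y +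
        gradient Q y = E y) ∧ W ≠ 0 := by
  refine ⟨fun _ => c, 0, fun z => -⟪(1 / 2 : ℝ) • c + α • cross (axis 2) c, z⟫,
    isBandLimited_const hL c, isDivFree_const c, ?_, isCobandLimited_zero_field L,
    fun y => ?_, ?_⟩
  · exact (contDiff_const.inner ℝ contDiff_id).neg
  · rw [Pi.zero_apply]
    exact linearProfile_const α c y
  · intro h
    exact hc (by simpa using congrFun h 0)

/-! ## The horizontal constant field inside the mean–wave letters at `(L, n) = (1, 1)` -/

/-- For a horizontal vector (`c₂ = 0`), `e₃ × (e₃ × c) = −c`. [folklore] -/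
private theorem cross_axis_two_twice {c : EuclideanSpace ℝ (Fin 3)} (hc : c 2 = 0) :
    cross (axis 2) (cross (axis 2) c) = -c := by
  apply PiLp.ext
  intro i
  fin_cases i <;> simp [cross, cross_apply, axis, hc]

/-- **A horizontal constant field is a `1`-fold azimuthal wave**: `J₃(J₃ c) = −1²·c` for `c ⊥ e₃`.
[folklore] -/
theorem wave_const_horizontal {c : EuclideanSpace ℝ (Fin 3)} (hc : c 2 = 0) (y : EuclideanSpace ℝ (Fin 3)) :
    angGen 2 (angGen 2 (fun _ : EuclideanSpace ℝ (Fin 3) => c)) y =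
      -((((1 : ℕ) : ℝ) ^ 2) • (fun _ : EuclideanSpace ℝ (Fin 3) => c) y) := by
  rw [angGen_const, angGen_const]
  simp only [cross_axis_two_twice hc, Nat.cast_one, one_pow, one_smul]

/-- **At `(L, n) = (1, 1)` the pair `(V, W) = (0, c)`, `c` horizontal, meets EVERY conjunct of
`Qlwave.IsMeanWaveProfile 1 1 α C 0 c 0 Q 0 0` except the Type-I tail** (letters unfolded;
`Q(y) = −⟪½c + α(e₃ × c), y⟫`): the window `1 < 2·1`, band-limitation, divergence-freeness,
zonality of `V = 0`, the wave law `J₃²c = −c`, smooth pressures, continuous co-band (zero) defects,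
the ZONAL equation (the constant wave has zero mean Reynolds stress) and the WAVE equation all
hold. With `c ≠ 0` the tail fails (`‖c‖ ≤ C/(‖y‖+1)` for all `y` forces `c = 0`), which is exactly
the hypothesis `PureWaveExclusion.pureWave_eq_zero` uses to kill it. [folklore] -/
theorem meanWave_letters_const_horizontal (α : ℝ) {c : EuclideanSpace ℝ (Fin 3)} (hc : c 2 = 0) :
    1 < 2 * 1 ∧ IsBandLimited 1 (0 : EuclideanSpace ℝ (Fin 3) → EuclideanSpace ℝ (Fin 3)) ∧
      IsBandLimited 1 (fun _ : EuclideanSpace ℝ (Fin 3) => c) ∧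
      VectorCalculus.IsDivFree (0 : EuclideanSpace ℝ (Fin 3) → EuclideanSpace ℝ (Fin 3)) ∧
      VectorCalculus.IsDivFree (fun _ : EuclideanSpace ℝ (Fin 3) => c) ∧
      (∀ y, angGen 2 (0 : EuclideanSpace ℝ (Fin 3) → EuclideanSpace ℝ (Fin 3)) y = 0) ∧
      (∀ y, angGen 2 (angGen 2 (fun _ : EuclideanSpace ℝ (Fin 3) => c)) y =
        -((((1 : ℕ) : ℝ) ^ 2) • (fun _ : EuclideanSpace ℝ (Fin 3) => c) y)) ∧
      ContDiff ℝ ∞ (fun _ : EuclideanSpace ℝ (Fin 3) => (0 : ℝ)) ∧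
      ContDiff ℝ ∞ (fun z : EuclideanSpace ℝ (Fin 3) => -⟪(1 / 2 : ℝ) • c + α • cross (axis 2) c, z⟫) ∧
      Continuous (0 : EuclideanSpace ℝ (Fin 3) → EuclideanSpace ℝ (Fin 3)) ∧
      Continuous (0 : EuclideanSpace ℝ (Fin 3) → EuclideanSpace ℝ (Fin 3)) ∧
      IsCobandLimited 1 (0 : EuclideanSpace ℝ (Fin 3) → EuclideanSpace ℝ (Fin 3)) ∧
      IsCobandLimited 1 (0 : EuclideanSpace ℝ (Fin 3) → EuclideanSpace ℝ (Fin 3)) ∧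
      (∀ y, -(Δ (0 : EuclideanSpace ℝ (Fin 3) → EuclideanSpace ℝ (Fin 3))) y +
          (1 / 2 : ℝ) • (0 : EuclideanSpace ℝ (Fin 3) → EuclideanSpace ℝ (Fin 3)) y +
          (1 / 2 : ℝ) • fderiv ℝ (0 : EuclideanSpace ℝ (Fin 3) → EuclideanSpace ℝ (Fin 3)) y y +
          convect (0 : EuclideanSpace ℝ (Fin 3) → EuclideanSpace ℝ (Fin 3))
            (0 : EuclideanSpace ℝ (Fin 3) → EuclideanSpace ℝ (Fin 3)) y +
          (1 / 2 : ℝ) • (convect (fun _ : EuclideanSpace ℝ (Fin 3) => c)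
              (fun _ : EuclideanSpace ℝ (Fin 3) => c) y +
            convect (fun y => ((1 : ℕ) : ℝ)⁻¹ • angGen 2 (fun _ : EuclideanSpace ℝ (Fin 3) => c) y)
              (fun y => ((1 : ℕ) : ℝ)⁻¹ • angGen 2 (fun _ : EuclideanSpace ℝ (Fin 3) => c) y) y) +
          gradient (fun _ : EuclideanSpace ℝ (Fin 3) => (0 : ℝ)) y =
        (0 : EuclideanSpace ℝ (Fin 3) → EuclideanSpace ℝ (Fin 3)) y) ∧
      (∀ y, -(Δ (fun _ : EuclideanSpace ℝ (Fin 3) => c)) y +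
          (1 / 2 : ℝ) • (fun _ : EuclideanSpace ℝ (Fin 3) => c) y +
          (1 / 2 : ℝ) • fderiv ℝ (fun _ : EuclideanSpace ℝ (Fin 3) => c) y y +
          α • angGen 2 (fun _ : EuclideanSpace ℝ (Fin 3) => c) y +
          convect (0 : EuclideanSpace ℝ (Fin 3) → EuclideanSpace ℝ (Fin 3))
            (fun _ : EuclideanSpace ℝ (Fin 3) => c) y +
          convect (fun _ : EuclideanSpace ℝ (Fin 3) => c)
            (0 : EuclideanSpace ℝ (Fin 3) → EuclideanSpace ℝ (Fin 3)) y +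
          gradient (fun z : EuclideanSpace ℝ (Fin 3) => -⟪(1 / 2 : ℝ) • c + α • cross (axis 2) c, z⟫) y =
        (0 : EuclideanSpace ℝ (Fin 3) → EuclideanSpace ℝ (Fin 3)) y) := by
  have hz : IsBandLimited 1 (0 : EuclideanSpace ℝ (Fin 3) → EuclideanSpace ℝ (Fin 3)) :=
    isBandLimited_zero_field 1
  have hcz : IsCobandLimited 1 (0 : EuclideanSpace ℝ (Fin 3) → EuclideanSpace ℝ (Fin 3)) :=
    isCobandLimited_zero_field 1
  have hf0 : ∀ y : EuclideanSpace ℝ (Fin 3),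
      fderiv ℝ (0 : EuclideanSpace ℝ (Fin 3) → EuclideanSpace ℝ (Fin 3)) y = 0 := fun y => by
    rw [show (0 : EuclideanSpace ℝ (Fin 3) → EuclideanSpace ℝ (Fin 3)) =
      fun _ => (0 : EuclideanSpace ℝ (Fin 3)) from rfl]; simp
  have hg0 : ∀ y : EuclideanSpace ℝ (Fin 3), gradient (fun _ : EuclideanSpace ℝ (Fin 3) => (0 : ℝ)) y = 0 :=
    fun y => by simp [gradient]
  have hdz : VectorCalculus.IsDivFree (0 : EuclideanSpace ℝ (Fin 3) → EuclideanSpace ℝ (Fin 3)) :=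
    fun x => by
      simp only [VectorCalculus.divergence, hf0 x, ContinuousLinearMap.toLinearMap_zero, map_zero]
  have hJ0 : angGen 2 (0 : EuclideanSpace ℝ (Fin 3) → EuclideanSpace ℝ (Fin 3)) = 0 := angGen_zero 2
  have hconv0 : ∀ (u v : EuclideanSpace ℝ (Fin 3) → EuclideanSpace ℝ (Fin 3))
      (y : EuclideanSpace ℝ (Fin 3)), fderiv ℝ v y = 0 → convect u v y = 0 := fun u v y h => by
    simp only [convect, h, _root_.zero_apply]
  have hJc : angGen 2 (fun _ : EuclideanSpace ℝ (Fin 3) => c) = fun _ => cross (axis 2) c :=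
    angGen_const 2 c
  have hconvc : ∀ y, convect (fun _ : EuclideanSpace ℝ (Fin 3) => c)
      (fun _ : EuclideanSpace ℝ (Fin 3) => c) y = 0 := fun y =>
    hconv0 _ _ y (by rw [fderiv_fun_const]; rfl)
  have hconvJ : ∀ y, convect (fun y => ((1 : ℕ) : ℝ)⁻¹ • angGen 2 (fun _ : EuclideanSpace ℝ (Fin 3) => c) y)
      (fun y => ((1 : ℕ) : ℝ)⁻¹ • angGen 2 (fun _ : EuclideanSpace ℝ (Fin 3) => c) y) y = 0 := fun y =>
    hconv0 _ _ y (by rw [hJc]; simp)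
  have hΔ0 : ∀ y : EuclideanSpace ℝ (Fin 3),
      (Δ (0 : EuclideanSpace ℝ (Fin 3) → EuclideanSpace ℝ (Fin 3))) y = 0 := fun y => by
    rw [show (0 : EuclideanSpace ℝ (Fin 3) → EuclideanSpace ℝ (Fin 3)) =
      fun _ => (0 : EuclideanSpace ℝ (Fin 3)) from rfl, InnerProductSpace.laplacian_const]; rfl
  refine ⟨by norm_num, hz, isBandLimited_one_const c, hdz, isDivFree_const c, fun y => ?_,
    fun y => wave_const_horizontal hc y, contDiff_const, (contDiff_const.inner ℝ contDiff_id).neg,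
    continuous_const, continuous_const, hcz, hcz, fun y => ?_, fun y => ?_⟩
  · rw [hJ0]; rfl
  · rw [hΔ0 y, hf0 y, hconv0 _ _ y (hf0 y), hconvc y, hconvJ y, hg0 y]
    simp
  · rw [hconv0 _ _ y (by rw [fderiv_fun_const]; rfl), hconv0 _ _ y (hf0 y), add_zero, add_zero]
    rw [linearProfile_const α c y]
    rfl

/-- **With `c ≠ 0` the tail is the ONLY failing letter**: the joint tail `‖0 + c‖ ≤ C/(‖y‖ + 1)`
for all `y` forces `c = 0`. [folklore] -/
theorem tail_fails_const {C : ℝ} {c : EuclideanSpace ℝ (Fin 3)}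
    (h : ∀ y : EuclideanSpace ℝ (Fin 3),
      ‖(0 : EuclideanSpace ℝ (Fin 3) → EuclideanSpace ℝ (Fin 3)) y + c‖ ≤ C / (‖y‖ + 1)) :
    c = 0 := by
  by_contra hc
  have hpos : 0 < ‖c‖ := norm_pos_iff.2 hc
  have hC : 0 ≤ C := by
    have h0 := h 0
    rw [Pi.zero_apply, zero_add, norm_zero, zero_add, div_one] at h0
    exact hpos.le.trans h0
  -- take `y = R • e` with `‖y‖ = C/‖c‖ + 1`
  obtain ⟨e, he⟩ : ∃ e : EuclideanSpace ℝ (Fin 3), e ≠ 0 := ⟨c, hc⟩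
  have hepos : 0 < ‖e‖ := norm_pos_iff.2 he
  set y : EuclideanSpace ℝ (Fin 3) := ((C / ‖c‖ + 1) / ‖e‖) • e with hy
  have hny : ‖y‖ = C / ‖c‖ + 1 := by
    rw [hy, norm_smul, Real.norm_of_nonneg (by positivity)]
    field_simp
  have h1 := h y
  rw [Pi.zero_apply, zero_add, hny] at h1
  have h2 : C / (C / ‖c‖ + 1 + 1) < ‖c‖ := by
    rw [div_lt_iff₀ (by positivity)]
    have : ‖c‖ * (C / ‖c‖ + 1 + 1) = C + 2 * ‖c‖ := by
      field_simp
      ring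
    rw [this]
    linarith
  linarith

end Summit.NavierStokesRegularity.AngularGalerkinLadderLinearProfileTailLoadBearing

end
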